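import Summits.ResolutionOfSingularities.ResolutionOfSingularities.Theorems.MarkedTransferCampaignW22PairRegLevelOne
import Summits.ResolutionOfSingularities.ResolutionOfSingularities.Theorems.MarkedTransferCampaignW22PairRootCriterion
import HarnessLib

/-!
# [OURS · L1 W2.2] The level-one pair rung (`UniformContactPairRegLevelOne`, p521389) IS a cell of the pair row, and its ROOT FORM

Cell `res-hironaka`, rung L of LADDER-RESOLUTION, RESCUE-SEED slot W2.2 (group L-G2); seat res-type-068 (gen 9, owner of the
last open pair cell `UniformContactPairRegDim p 5`, OFFER-13 object (α), STATUS 2026-08-27T09:50:28Z); `--supports` helper of the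
host item `MarkedTransfer.MarkedOrderReductionP` (stmt-ResolutionOfSingularities-15520). Companion of res-L1-type-o3's statement
file `…W22PairRegLevelOne.lean` (p521389) and of this seat's root criterion `…W22PairRootCriterion.lean` (p510889).

HONEST FRAMING. OURS bookkeeping between OURS rows; NOTHING here is a statement of H. Hironaka's manuscript *Resolution of
singularities in positive characteristics* (2017-03-23, [Hironaka2017], lit key `paper:url-3343fd9e678b`) or of any cited
paper, and nothing here asserts that any statement of that text holds. The file decides no open cell: it proves the two
formal links every consumer of p521389 needs. AI mathematics checked by the kernel; AI review is weaker than expert review.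

WHAT IS PROVED (`O` regular local of characteristic `p`, `q = p^e`):
* `uniformContactPairRegLevelOneOn_of_uniformContactPairRegOn` — the pair rung in the printed regime (p504962
  `UniformContactPairRegOn`) implies its level-one cell (p521389 `UniformContactPairRegLevelOneOn`): a head with
  `ε ∈ 𝔪^(q+1)` has `ord ε ≥ q + 1`, and an order-safe output then satisfies `Y − y ∈ 𝔪^⌈ord ε/q⌉ ⊆ 𝔪²`
  (`orderSafeAt_iff_sub_mem_pow`, p510889); `ε = 0` by primality of the centres.
* `UniformContactPairRegLevelOne_of_UniformContactPairRegDim_five` — OFFER-13 (α): `UniformContactPairRegDim p 5 →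
  UniformContactPairRegLevelOne p` (specialise to `n = 5`).
* `uniformContactPairRegLevelOneOn_iff_root` — ROOT FORM of the level-one cell: `UniformContactPairRegLevelOneOn p O ↔
  ∀ e, ∀ y with adicOrder y = 1, ∀ proper coordinate centres P₁ P₂: y^q ∈ (P₁^q ⊓ P₂^q) ⊔ 𝔪^(q+1) → y ∈ (P₁ ⊓ P₂) ⊔ 𝔪²`
  — ONE membership implication per (head variable, pair), the form the exact searches test (res-type-068 kit jobs; res-L1-type-o3
  UNIFORM-CONTACT-SKETCH.md §17.9/§17.10).

## References
* Cell files (tree): `…W22PairRegLevelOne.lean` (p521389, the cell), `…W22PairRootCriterion.lean` (p510889),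
  `…W22UniformContactReg.lean` (p504962), `…W22ContactSafeProof.lean` (`isPrime_span_image_of_isRegularSystemOfParameters`).
* H. Hironaka, ms. 2017-03-23, p.84 l.41 «ending with ord_ξ(g(e)) = 1», p.85 l.3 «center D ⊂ ∇ which is permissible» — ROLES
  only; under adjudication, not cited as fact. [Hironaka2017] [claim: Hironaka2017, status: under-review]
* H. Matsumura, *Commutative Ring Theory*, CUP 1986, §14. [Matsumura1987]
-/

set_option linter.dupNamespace false -- mandated namespace of this single-conjunct summit

namespace Summit.ResolutionOfSingularities.ResolutionOfSingularities.Theorems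

namespace CampaignW22

open Literature.AlgebraicGeometry.Resolution
open Literature.AlgebraicGeometry.Hironaka2017.S06BaseHike
open IsLocalRing

universe u

variable {O : Type u} [CommRing O] [IsRegularLocalRing O] (p : ℕ) [Fact p.Prime] [CharP O p]

/-- [OURS · L1 W2.2] The printed-regime pair rung implies its LEVEL-ONE cell on the same ring: if every nondegenerate head
with `ord ε > p^e` and every two permissible proper coordinate centres admit a common ORDER-SAFE output, then for heads
with `ε ∈ 𝔪^(p^e+1)` the common output can be taken with `Y − y ∈ 𝔪²` (indeed `⌈ord ε / p^e⌉ ≥ 2`; for `ε = 0` the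
centres are prime and `Y := y` serves). Replaces the role of «center D ⊂ ∇, permissible» (p.85 l.3) for two centres at
threshold `𝔪²`; NOT a statement of the manuscript or of any cited paper. [folklore] -/
theorem uniformContactPairRegLevelOneOn_of_uniformContactPairRegOn (h : UniformContactPairRegOn p O) :
    UniformContactPairRegLevelOneOn p O := by
  haveI : IsDomain O := isDomain_of_isRegularLocalRing O
  intro e y ε hy hε n₁ n₂ x₁ x₂ hx₁ hx₂ S₁ S₂ hS₁ hS₂ hg₁ hg₂
  have hqne : p ^ e ≠ 0 := (pow_pos (Fact.out : p.Prime).pos e).ne'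
  by_cases hε0 : ε = 0
  · subst hε0
    rw [add_zero] at hg₁ hg₂
    refine ⟨y, by rw [sub_self]; exact zero_mem _, ?_, ?_⟩
    · exact (isPrime_span_image_of_isRegularSystemOfParameters hx₁ S₁).mem_of_pow_mem _
        (Ideal.pow_le_self hqne hg₁)
    · exact (isPrime_span_image_of_isRegularSystemOfParameters hx₂ S₂).mem_of_pow_mem _
        (Ideal.pow_le_self hqne hg₂)
  · obtain ⟨d, hd⟩ := ENat.ne_top_iff_exists.mp (adicOrder_ne_top hε0)
    have hdle : ((p ^ e + 1 : ℕ) : ℕ∞) ≤ adicOrder ε := (le_adicOrder_iff ε (p ^ e + 1)).mpr hε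
    have hqd : p ^ e + 1 ≤ d := by
      have : ((p ^ e + 1 : ℕ) : ℕ∞) ≤ (d : ℕ∞) := by rw [hd]; exact hdle
      exact_mod_cast this
    have hq : ((p ^ e : ℕ) : ℕ∞) < adicOrder ε := by
      rw [← hd]; exact_mod_cast (Nat.lt_of_lt_of_le (Nat.lt_succ_self _) hqd)
    obtain ⟨Y, hT1, hY₁, hY₂⟩ := h e y ε hy hq n₁ n₂ x₁ x₂ hx₁ hx₂ S₁ S₂ hS₁ hS₂ hg₁ hg₂
    refine ⟨Y, ?_, hY₁, hY₂⟩
    have hT1' := (orderSafeAt_iff_sub_mem_pow p e y ε Y hd.symm).mp hT1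
    have h2 : 2 ≤ (d + p ^ e - 1) / p ^ e := by
      rw [Nat.le_div_iff_mul_le (pow_pos (Fact.out : p.Prime).pos e)]
      omega
    exact Ideal.pow_le_pow_right h2 hT1'

/-- [OURS · L1 W2.2] OFFER-13 object (α) (res-L1-type-o3 2026-08-27T09:21:24Z, owner word res-type-068 09:50:28Z): the
dimension-5 cell of the printed-regime pair row (`UniformContactPairRegDim p 5`, p504962 — the last open pair cell)
implies the level-one cell `UniformContactPairRegLevelOne p` (p521389). So a kernel refutation of the level-one cell
refutes the row cell, and a proof of the row cell contains the level-one cell. NOT a statement of the manuscript or of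
any cited paper. [folklore] -/
theorem UniformContactPairRegLevelOne_of_UniformContactPairRegDim_five
    (h : UniformContactPairRegDim p 5) : UniformContactPairRegLevelOne p := by
  intro K _ _ _
  letI : IsRegularLocalRing (MvPowerSeries (Fin 5) K) := isRegularLocalRing_mvPowerSeries K (Fin 5)
  haveI : CharP (MvPowerSeries (Fin 5) K) p :=
    charP_of_injective_algebraMap (MvPowerSeries.C_injective (σ := Fin 5) (R := K)) p
  exact uniformContactPairRegLevelOneOn_of_uniformContactPairRegOn p (h K 5 le_rfl)

omit [Fact p.Prime] [CharP O p] in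
/-- [OURS · L1 W2.2] ROOT FORM of the level-one cell: on a regular local ring of characteristic `p`,
`UniformContactPairRegLevelOneOn p O` holds iff for every `e`, every regular parameter `y` (`adicOrder y = 1`) and every
two proper coordinate centres `P₁ = (x₁ '' S₁)`, `P₂ = (x₂ '' S₂)`:
`y^(p^e) ∈ (P₁^(p^e) ⊓ P₂^(p^e)) ⊔ 𝔪^(p^e+1) → y ∈ (P₁ ⊓ P₂) ⊔ 𝔪²` — one membership implication per (head variable,
pair), which is what the exact searches decide configuration by configuration (res-type-068's kit jobs; res-L1-type-o3's
`W_q` / `𝔠'_q` of UNIFORM-CONTACT-SKETCH §17.9–17.10). (→: realise the hypothesis by the head `(e, y, −ε')`,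
`y^q = η + ε'`; ←: `y^q = (y^q + ε) − ε`.) NOT a statement of the manuscript or of any cited paper. [folklore] -/
theorem uniformContactPairRegLevelOneOn_iff_root :
    UniformContactPairRegLevelOneOn p O ↔
      ∀ (e : ℕ) (y : O), adicOrder y = 1 →
        ∀ (n₁ n₂ : ℕ) (x₁ : Fin n₁ → O) (x₂ : Fin n₂ → O), IsRegularSystemOfParameters x₁ →
          IsRegularSystemOfParameters x₂ → ∀ (S₁ : Set (Fin n₁)) (S₂ : Set (Fin n₂)), S₁.Nonempty → S₂.Nonempty →
            y ^ p ^ e ∈ (Ideal.span (x₁ '' S₁) ^ p ^ e ⊓ Ideal.span (x₂ '' S₂) ^ p ^ e) ⊔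
                maximalIdeal O ^ (p ^ e + 1) →
              y ∈ (Ideal.span (x₁ '' S₁) ⊓ Ideal.span (x₂ '' S₂)) ⊔ maximalIdeal O ^ 2 := by
  constructor
  · intro h e y hy n₁ n₂ x₁ x₂ hx₁ hx₂ S₁ S₂ hS₁ hS₂ hroot
    obtain ⟨η, hη, ε', hε', hsum⟩ := Submodule.mem_sup.mp hroot
    have hg : y ^ p ^ e + -ε' = η := by rw [← hsum]; ring
    obtain ⟨Y, hY, hY₁, hY₂⟩ := h e y (-ε') hy (neg_mem hε') n₁ n₂ x₁ x₂ hx₁ hx₂ S₁ S₂ hS₁ hS₂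
      (by rw [hg]; exact hη.1) (by rw [hg]; exact hη.2)
    have hy' : y = Y + -(Y - y) := by ring
    rw [hy']
    exact Submodule.add_mem_sup ⟨hY₁, hY₂⟩ (neg_mem hY)
  · intro h e y ε hy hε n₁ n₂ x₁ x₂ hx₁ hx₂ S₁ S₂ hS₁ hS₂ hg₁ hg₂
    have hroot : y ^ p ^ e ∈ (Ideal.span (x₁ '' S₁) ^ p ^ e ⊓ Ideal.span (x₂ '' S₂) ^ p ^ e) ⊔
        maximalIdeal O ^ (p ^ e + 1) := by
      have hy' : y ^ p ^ e = (y ^ p ^ e + ε) + -ε := by ring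
      rw [hy']
      exact Submodule.add_mem_sup ⟨hg₁, hg₂⟩ (neg_mem hε)
    obtain ⟨Y, hY, t, ht, hYt⟩ := Submodule.mem_sup.mp (h e y hy n₁ n₂ x₁ x₂ hx₁ hx₂ S₁ S₂ hS₁ hS₂ hroot)
    refine ⟨Y, ?_, hY.1, hY.2⟩
    have : Y - y = -t := by rw [← hYt]; ring
    rw [this]
    exact neg_mem ht

end CampaignW22

end Summit.ResolutionOfSingularities.ResolutionOfSingularities.Theorems
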